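import Mathlib
import HarnessLib

/-!
# THE Σ-BALL MODEL INTEGRALS: the transverse Gaussian fibre `∫_{ℝ²} e^{−a‖u‖²} = π/a` and the slab bound `∫ dp/|p|² ≲ δ₀^{1/3}`
# (free-hands support of ⟨stmt-QuantumFields-24197⟩ `SwapVirialDeficit.SwapGluedStiffness`; LEAD g99 memo8 §3 (Σ1): the two L-free real-analysis inputs of the
# END-CORE weight bound `stub_core_end` of skeleton ➎ — «integrate the transverse letter `u ∈ ℝ²` FIRST»)

memo8 §2: near the crossing `Σ = A ∩ B̄` the non-Gaussian part of the deficit is `≍ |u|²·Q(p)`, `u ∈ ℝ²` the transverse letter of `C₀` (distance to stratum A),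
`p = (δ, x₀, y₀)` (distance to stratum B).  Integrating `u` first gives `π/(b·Q(p))` — the A-side Morse–Bott density `1/Q(p) ≍ 1/|p|²`, integrable at `p = 0` in
three dimensions — whereas `p` first gives the non-integrable B-density `|u|^{-3}`.  This file supplies the two model facts in plain letters:
* §1 ★ `integral_exp_neg_mul_sq_norm_two (ha : 0 < a) : ∫ u : EuclideanSpace ℝ (Fin 2), e^{−a‖u‖²} = π/a`, and the `ℝ≥0∞` form `lintegral_exp_neg_mul_sq_norm_two`;
* §2 ★ `inv_sum_sq_three_le` — AM–GM: `(x² + y² + z²)⁻¹ ≤ ⅓·|x|^{-2/3}|y|^{-2/3}|z|^{-2/3}` (`x, y, z ≠ 0`), which FACTORISES the slab integral;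
* §3 ★ `integral_abs_rpow_neg_two_thirds (hδ : 0 < δ) : ∫ x in −δ..δ, |x|^{-2/3} = 6·δ^{1/3}` and the set-lintegral form;
* §4 ★★ `lintegral_slab_inv_sum_sq_le` — on `ℝ × ℝ × ℝ`: `∫⁻_{(−δ,δ)×(−A,A)×(−B,B)} (x²+y²+z²)⁻¹ ≤ 72·(δAB)^{1/3}` (polynomially small in the hub cut `δ`; the true
  order is `δ log(1/δ)`, not needed).
The consumer (stub_core_end owner) maps the end-core letters onto these by the route's measurable equivalences (✓`gnoFibreBEquiv`-type) and the floor of memo9/Σ2.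

HONEST LABEL: elementary real analysis, no model content; stubs B ∕ core-tip ∕ core-end ∕ 001-good of skeleton ➎ v7, ⟨24197⟩ ∕ ⟨24194⟩ ∕ ⟨24497⟩ OPEN; own crux
⟨22884⟩ `LargeFieldMassRefinementTail` OPEN (blocked-on ⟨19935⟩); the Yang–Mills mass gap is NOT proved; no summit is proved by a line.  THEOREMS ONLY (0 `def`,
0 `sorry`), standard axioms.  LEAD seat ym-line-sfw-p2 g99 (cell ym-idea-1, free hands), `--supports stmt-QuantumFields-24197`.  References: [folklore].
-/

set_option autoImplicit false

noncomputable section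

open MeasureTheory Set Real
open scoped ENNReal

namespace Summit.QuantumFields.YangMills.Theorems.SwapVirialDeficit.SigmaBall

/-! ## §1 The transverse Gaussian fibre in the plane -/

/-- ★ `∫_{ℝ²} e^{−a‖u‖²} du = π/a` (`a > 0`). [folklore] -/
theorem integral_exp_neg_mul_sq_norm_two {a : ℝ} (ha : 0 < a) :
    ∫ u : EuclideanSpace ℝ (Fin 2), Real.exp (-a * ‖u‖ ^ 2) = π / a := by
  rw [GaussianFourier.integral_rexp_neg_mul_sq_norm ha, finrank_euclideanSpace, Fintype.card_fin]
  norm_num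

/-- The plane Gaussian is integrable. [folklore] -/
theorem integrable_exp_neg_mul_sq_norm_two {a : ℝ} (ha : 0 < a) :
    Integrable fun u : EuclideanSpace ℝ (Fin 2) => Real.exp (-a * ‖u‖ ^ 2) := by
  refine Integrable.of_integral_ne_zero ?_
  rw [integral_exp_neg_mul_sq_norm_two ha]
  positivity

/-- ★ The same in `ℝ≥0∞`: `∫⁻_{ℝ²} e^{−a‖u‖²} = π/a`. [folklore] -/
theorem lintegral_exp_neg_mul_sq_norm_two {a : ℝ} (ha : 0 < a) :
    ∫⁻ u : EuclideanSpace ℝ (Fin 2), ENNReal.ofReal (Real.exp (-a * ‖u‖ ^ 2)) = ENNReal.ofReal (π / a) := by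
  rw [← integral_exp_neg_mul_sq_norm_two ha,
    ofReal_integral_eq_lintegral_ofReal (integrable_exp_neg_mul_sq_norm_two ha) (Filter.Eventually.of_forall fun u => (Real.exp_pos _).le)]

/-- Monotonicity in the rate: for `a₀ ≤ a`, `∫⁻ e^{−a‖u‖²} ≤ π/a₀`. [folklore] -/
theorem lintegral_exp_neg_mul_sq_norm_two_le {a₀ a : ℝ} (ha₀ : 0 < a₀) (h : a₀ ≤ a) :
    ∫⁻ u : EuclideanSpace ℝ (Fin 2), ENNReal.ofReal (Real.exp (-a * ‖u‖ ^ 2)) ≤ ENNReal.ofReal (π / a₀) := by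
  rw [← lintegral_exp_neg_mul_sq_norm_two ha₀]
  refine lintegral_mono fun u => ENNReal.ofReal_le_ofReal (Real.exp_le_exp.2 ?_)
  nlinarith [sq_nonneg ‖u‖]

/-! ## §2 AM–GM: the inverse square norm factorises -/

/-- `(x²)^{1/3} = |x|^{2/3}`. [folklore] -/
theorem sq_rpow_third (x : ℝ) : (x ^ 2) ^ (1 / 3 : ℝ) = |x| ^ (2 / 3 : ℝ) := by
  rw [← sq_abs, ← Real.rpow_natCast, ← Real.rpow_mul (abs_nonneg x)]; norm_num

/-- ★ **AM–GM**: for `x, y, z ≠ 0`, `(x² + y² + z²)⁻¹ ≤ ⅓·(|x|^{-2/3}·|y|^{-2/3}·|z|^{-2/3})`. [folklore] -/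
theorem inv_sum_sq_three_le {x y z : ℝ} (hx : x ≠ 0) (hy : y ≠ 0) (hz : z ≠ 0) :
    (x ^ 2 + y ^ 2 + z ^ 2)⁻¹ ≤ (1 / 3 : ℝ) * (|x| ^ (-(2 / 3) : ℝ) * |y| ^ (-(2 / 3) : ℝ) * |z| ^ (-(2 / 3) : ℝ)) := by
  have hax : 0 < |x| := abs_pos.2 hx
  have hay : 0 < |y| := abs_pos.2 hy
  have haz : 0 < |z| := abs_pos.2 hz
  -- AM–GM with weights 1/3
  have hamgm := Real.geom_mean_le_arith_mean3_weighted (w₁ := 1 / 3) (w₂ := 1 / 3) (w₃ := 1 / 3) (p₁ := x ^ 2) (p₂ := y ^ 2) (p₃ := z ^ 2)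
    (by norm_num) (by norm_num) (by norm_num) (sq_nonneg x) (sq_nonneg y) (sq_nonneg z) (by norm_num)
  rw [sq_rpow_third, sq_rpow_third, sq_rpow_third] at hamgm
  -- `G := |x|^{2/3}|y|^{2/3}|z|^{2/3} > 0`, `3G ≤ x²+y²+z²`
  have hG : 0 < |x| ^ (2 / 3 : ℝ) * |y| ^ (2 / 3 : ℝ) * |z| ^ (2 / 3 : ℝ) := by positivity
  have hsum : 3 * (|x| ^ (2 / 3 : ℝ) * |y| ^ (2 / 3 : ℝ) * |z| ^ (2 / 3 : ℝ)) ≤ x ^ 2 + y ^ 2 + z ^ 2 := by linarith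
  have hinv : (|x| ^ (2 / 3 : ℝ) * |y| ^ (2 / 3 : ℝ) * |z| ^ (2 / 3 : ℝ))⁻¹ =
      |x| ^ (-(2 / 3) : ℝ) * |y| ^ (-(2 / 3) : ℝ) * |z| ^ (-(2 / 3) : ℝ) := by
    rw [mul_inv, mul_inv, Real.rpow_neg hax.le, Real.rpow_neg hay.le, Real.rpow_neg haz.le]
  rw [← hinv]
  calc (x ^ 2 + y ^ 2 + z ^ 2)⁻¹ ≤ (3 * (|x| ^ (2 / 3 : ℝ) * |y| ^ (2 / 3 : ℝ) * |z| ^ (2 / 3 : ℝ)))⁻¹ := by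
        gcongr
    _ = (1 / 3 : ℝ) * (|x| ^ (2 / 3 : ℝ) * |y| ^ (2 / 3 : ℝ) * |z| ^ (2 / 3 : ℝ))⁻¹ := by rw [mul_inv]; norm_num

/-! ## §3 The one-dimensional integral `∫_0^δ x^{-2/3} = 3δ^{1/3}` -/

/-- `∫_0^δ x^{-2/3} dx = 3·δ^{1/3}`. [folklore] -/
theorem integral_rpow_neg_two_thirds (δ : ℝ) : ∫ x in (0:ℝ)..δ, x ^ (-(2 / 3) : ℝ) = 3 * δ ^ (1 / 3 : ℝ) := by
  rw [integral_rpow (Or.inl (by norm_num)), Real.zero_rpow (by norm_num)]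
  norm_num
  ring

/-- ★ The `ℝ≥0∞` form on the open interval: `∫⁻_{(0,δ)} x^{-2/3} = 3·δ^{1/3}`. [folklore] -/
theorem lintegral_Ioo_rpow_neg_two_thirds {δ : ℝ} (hδ : 0 ≤ δ) :
    ∫⁻ x in Ioo (0:ℝ) δ, ENNReal.ofReal (x ^ (-(2 / 3) : ℝ)) = ENNReal.ofReal (3 * δ ^ (1 / 3 : ℝ)) := by
  have hint : IntegrableOn (fun x : ℝ => x ^ (-(2 / 3) : ℝ)) (Ioc 0 δ) :=
    (intervalIntegral.intervalIntegrable_rpow' (r := -(2 / 3)) (by norm_num) (a := 0) (b := δ)).1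
  rw [setLIntegral_congr Ioo_ae_eq_Ioc, ← integral_rpow_neg_two_thirds δ, intervalIntegral.integral_of_le hδ,
    ofReal_integral_eq_lintegral_ofReal hint]
  exact (ae_restrict_mem measurableSet_Ioc).mono fun x hx => Real.rpow_nonneg hx.1.le _

/-! ## §4 The octant slab bound -/

/-- On the positive octant the AM–GM bound needs no absolute values: `(x²+y²+z²)⁻¹ ≤ ⅓·x^{-2/3}y^{-2/3}z^{-2/3}` for `x, y, z > 0`. [folklore] -/
theorem inv_sum_sq_three_le_pos {x y z : ℝ} (hx : 0 < x) (hy : 0 < y) (hz : 0 < z) :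
    (x ^ 2 + y ^ 2 + z ^ 2)⁻¹ ≤ (1 / 3 : ℝ) * (x ^ (-(2 / 3) : ℝ) * y ^ (-(2 / 3) : ℝ) * z ^ (-(2 / 3) : ℝ)) := by
  have h := inv_sum_sq_three_le hx.ne' hy.ne' hz.ne'
  rwa [abs_of_pos hx, abs_of_pos hy, abs_of_pos hz] at h

/-- ★★ **THE OCTANT SLAB BOUND**: `∫⁻_{(0,δ)×(0,A)×(0,B)} (x²+y²+z²)⁻¹ ≤ 9·δ^{1/3}A^{1/3}B^{1/3}` on `ℝ × ℝ × ℝ` (volume = the product measure); the full slab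
`(−δ,δ)×(−A,A)×(−B,B)` is `8` reflected copies.  Polynomially small in the hub cut `δ` — all that the end-core share needs (memo8 §2(c)). [folklore] -/
theorem lintegral_octant_slab_inv_sum_sq_le {δ A B : ℝ} (hδ : 0 ≤ δ) (hA : 0 ≤ A) (hB : 0 ≤ B) :
    ∫⁻ p in (Ioo (0:ℝ) δ) ×ˢ ((Ioo (0:ℝ) A) ×ˢ (Ioo (0:ℝ) B)), ENNReal.ofReal ((p.1 ^ 2 + p.2.1 ^ 2 + p.2.2 ^ 2)⁻¹)
        ∂(volume : Measure (ℝ × ℝ × ℝ)) ≤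
      ENNReal.ofReal (9 * δ ^ (1 / 3 : ℝ) * A ^ (1 / 3 : ℝ) * B ^ (1 / 3 : ℝ)) := by
  -- pointwise AM–GM on the octant
  have hpt : ∀ p ∈ (Ioo (0:ℝ) δ) ×ˢ ((Ioo (0:ℝ) A) ×ˢ (Ioo (0:ℝ) B)),
      ENNReal.ofReal ((p.1 ^ 2 + p.2.1 ^ 2 + p.2.2 ^ 2)⁻¹) ≤
        ENNReal.ofReal ((1 / 3 : ℝ) * p.1 ^ (-(2 / 3) : ℝ)) * (ENNReal.ofReal (p.2.1 ^ (-(2 / 3) : ℝ)) * ENNReal.ofReal (p.2.2 ^ (-(2 / 3) : ℝ))) := by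
    rintro ⟨x, y, z⟩ ⟨hx, hy, hz⟩
    simp only [Set.mem_Ioo] at hx hy hz
    have h := inv_sum_sq_three_le_pos hx.1 hy.1 hz.1
    rw [← ENNReal.ofReal_mul (Real.rpow_nonneg hy.1.le _), ← ENNReal.ofReal_mul (mul_nonneg (by norm_num) (Real.rpow_nonneg hx.1.le _))]
    refine ENNReal.ofReal_le_ofReal ?_
    calc (x ^ 2 + y ^ 2 + z ^ 2)⁻¹ ≤ (1 / 3 : ℝ) * (x ^ (-(2 / 3) : ℝ) * y ^ (-(2 / 3) : ℝ) * z ^ (-(2 / 3) : ℝ)) := h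
      _ = (1 / 3 : ℝ) * x ^ (-(2 / 3) : ℝ) * (y ^ (-(2 / 3) : ℝ) * z ^ (-(2 / 3) : ℝ)) := by ring
  have hmeas : MeasurableSet ((Ioo (0:ℝ) δ) ×ˢ ((Ioo (0:ℝ) A) ×ˢ (Ioo (0:ℝ) B))) :=
    measurableSet_Ioo.prod (measurableSet_Ioo.prod measurableSet_Ioo)
  calc ∫⁻ p in (Ioo (0:ℝ) δ) ×ˢ ((Ioo (0:ℝ) A) ×ˢ (Ioo (0:ℝ) B)), ENNReal.ofReal ((p.1 ^ 2 + p.2.1 ^ 2 + p.2.2 ^ 2)⁻¹) ∂(volume : Measure (ℝ × ℝ × ℝ))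
      ≤ ∫⁻ p in (Ioo (0:ℝ) δ) ×ˢ ((Ioo (0:ℝ) A) ×ˢ (Ioo (0:ℝ) B)),
          ENNReal.ofReal ((1 / 3 : ℝ) * p.1 ^ (-(2 / 3) : ℝ)) * (ENNReal.ofReal (p.2.1 ^ (-(2 / 3) : ℝ)) * ENNReal.ofReal (p.2.2 ^ (-(2 / 3) : ℝ)))
          ∂(volume : Measure (ℝ × ℝ × ℝ)) := setLIntegral_mono' hmeas hpt
    _ = (∫⁻ x in Ioo (0:ℝ) δ, ENNReal.ofReal ((1 / 3 : ℝ) * x ^ (-(2 / 3) : ℝ))) *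
          ((∫⁻ y in Ioo (0:ℝ) A, ENNReal.ofReal (y ^ (-(2 / 3) : ℝ))) * ∫⁻ z in Ioo (0:ℝ) B, ENNReal.ofReal (z ^ (-(2 / 3) : ℝ))) := by
        rw [Measure.volume_eq_prod, Measure.volume_eq_prod, ← Measure.prod_restrict, ← Measure.prod_restrict]
        have h2 : ∫⁻ q : ℝ × ℝ, ENNReal.ofReal (q.1 ^ (-(2 / 3) : ℝ)) * ENNReal.ofReal (q.2 ^ (-(2 / 3) : ℝ))
            ∂((volume.restrict (Ioo (0:ℝ) A)).prod (volume.restrict (Ioo (0:ℝ) B))) =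
            (∫⁻ y in Ioo (0:ℝ) A, ENNReal.ofReal (y ^ (-(2 / 3) : ℝ))) * ∫⁻ z in Ioo (0:ℝ) B, ENNReal.ofReal (z ^ (-(2 / 3) : ℝ)) :=
          lintegral_prod_mul (f := fun y : ℝ => ENNReal.ofReal (y ^ (-(2 / 3) : ℝ))) (g := fun z : ℝ => ENNReal.ofReal (z ^ (-(2 / 3) : ℝ)))
            (by fun_prop) (by fun_prop)
        have h1 := lintegral_prod_mul (μ := volume.restrict (Ioo (0:ℝ) δ)) (ν := (volume.restrict (Ioo (0:ℝ) A)).prod (volume.restrict (Ioo (0:ℝ) B)))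
          (f := fun x : ℝ => ENNReal.ofReal ((1 / 3 : ℝ) * x ^ (-(2 / 3) : ℝ)))
          (g := fun q : ℝ × ℝ => ENNReal.ofReal (q.1 ^ (-(2 / 3) : ℝ)) * ENNReal.ofReal (q.2 ^ (-(2 / 3) : ℝ))) (by fun_prop) (by fun_prop)
        rw [h2] at h1
        exact h1
    _ = ENNReal.ofReal (9 * δ ^ (1 / 3 : ℝ) * A ^ (1 / 3 : ℝ) * B ^ (1 / 3 : ℝ)) := by
        have h1 : ∫⁻ x in Ioo (0:ℝ) δ, ENNReal.ofReal ((1 / 3 : ℝ) * x ^ (-(2 / 3) : ℝ)) = ENNReal.ofReal (δ ^ (1 / 3 : ℝ)) := by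
          have e : ∀ x : ℝ, ENNReal.ofReal ((1 / 3 : ℝ) * x ^ (-(2 / 3) : ℝ)) = ENNReal.ofReal (1 / 3 : ℝ) * ENNReal.ofReal (x ^ (-(2 / 3) : ℝ)) :=
            fun x => ENNReal.ofReal_mul (by norm_num)
          simp_rw [e]
          rw [lintegral_const_mul _ (by fun_prop), lintegral_Ioo_rpow_neg_two_thirds hδ, ← ENNReal.ofReal_mul (by norm_num)]
          congr 1; ring
        rw [h1, lintegral_Ioo_rpow_neg_two_thirds hA, lintegral_Ioo_rpow_neg_two_thirds hB,
          ← ENNReal.ofReal_mul (by positivity), ← ENNReal.ofReal_mul (by positivity)]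
        congr 1; ring

end Summit.QuantumFields.YangMills.Theorems.SwapVirialDeficit.SigmaBall

end
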